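import Literature.AnabelianGeometry.SemiGraphs.OneVertexCuspsChart
import Literature.AnabelianGeometry.SemiGraphs.SpecialFibreTowerOfCharLevels
import HarnessLib

/-!
# One vertex with cusps over an OPEN SUBGROUP: an estranged family of closed subgroups of a profinite
# group `Δ` restricts to an estranged family in every open subgroup `N ≤ Δ` — the Thm. 3.7 fibre over `N`
# ([SemiAnbd] Def. 2.4 (iv) p. 26, Ex. 3.10 p. 44: the level fibres `𝒢_i` of the tower over `N_i ≤ Δ`)

Mochizuki, *Semi-graphs of anabelioids*, Publ. RIMS **42** (2006) [SemiAnbd], Def. 2.4 (iv) p. 26 (estranged),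
Example 3.10 p. 44 («`N_i` determines a finite log étale covering … whose geometric special fiber gives rise to
semi-graphs of anabelioids `𝒢_i`, `𝒢^c_i`» — the cusps of the covering are its open edges, with inertia groups
`I_x ∩ N_i`) [cite: MochizukiSemiAnbd2006, Ex 3.10 p.44].

Sequel (abc-iut cell, layer L3, seat abc-iut-L3-t11 gen 6, step (B3b) of the row «NV-hLG@cusped» /
«CUSP-ABS·NONDEGENERATE-NV») of `OneVertexCuspsHypotheses.lean` (p476844) and `ProfiniteFreeTwoTwistedCusps.lean`:
the fibre of a cusped Example 3.10 tower at the level `N ≤ Δ` is the one-vertex semi-graph of anabelioids with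
vertex group `N` and cusp groups `C_k ∩ N`.  For a profinite group `Δ`, a subgroup `N`, and a family
`C : ι → Subgroup Δ`:

* `OneVertexCusps.restrictEmb N C k : ↥((C k).subgroupOf N) →ₜ* ↥N` — the inclusions (injective); the graph
  `OneVertexCusps.restrictGraph N C := graph ↥N (fun k => ↥((C k).subgroupOf N)) (restrictEmb N C)`;
* `restrict_estranged` — the ESTRANGEMENT LAW transfers from `Δ` to `N`: if `C k ∩ g C k' g⁻¹ = 1` in `Δ` whenever
  `k' ≠ k` or `g ∉ C k`, then the same holds for the `(C k) ∩ N` inside `N`;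
* `infinite_subgroupOf_of_finiteIndex` — `C k ∩ N` is infinite when `C k` is and `N` has finite index;
* **`OneVertexCusps.restrict_thm37Hypotheses`** — for `Δ` slim Hausdorff profinite, `N` OPEN, `ι` finite, the
  `C k` closed, infinite and estranged in `Δ`, and an ELEVATION DATUM for `N` against the `C k ∩ N`, the fibre
  `restrictGraph N C` satisfies the hypotheses of [SemiAnbd] Thm. 3.7 (level family on `N` by abc-iut-L3-t2's
  `LevelFamily.nonempty_of_infinite`; slimness of the open subgroup `N`); its explicit tempered fundamental group
  is `N` itself (`OneVertexCusps.chart`, `restrictChart_G`).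

So the ONLY level-specific input left for the cusped tower over `F̂₂` is the elevation datum.  Structure /
consistency only; no statement of the paper is touched; no instance, no notation, no `Prop` fact.  Nothing here
bears on [IUTchIII] Cor. 3.12.
-/

noncomputable section

open Topology CategoryTheory

namespace Literature.AnabelianGeometry.SemiGraphs

open Literature.AlgebraicGeometry.Frobenioids (IsSlimGroup)

namespace OneVertexCusps

open ProfiniteSemiGraph

universe u

variable {Δ : Type u} [Group Δ] [TopologicalSpace Δ]
variable {ι : Type u} (N : Subgroup Δ) (C : ι → Subgroup Δ)

/-! ## 1. The restricted family and its inclusions -/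

/-- The inclusion `C_k ∩ N ↪ N` as a continuous homomorphism (the branch map of the cusp `k` of the fibre over
`N`). [cite: MochizukiSemiAnbd2006, Ex 3.10 p.44] -/
def restrictEmb (k : ι) : ↥((C k).subgroupOf N) →ₜ* N where
  toMonoidHom := ((C k).subgroupOf N).subtype
  continuous_toFun := continuous_subtype_val

/-- The inclusion is the coercion. [cite: MochizukiSemiAnbd2006, Ex 3.10 p.44] -/
@[simp] theorem restrictEmb_apply (k : ι) (x : (C k).subgroupOf N) : restrictEmb N C k x = (x : N) := rfl

/-- The inclusions are injective. [cite: MochizukiSemiAnbd2006, Def 2.1 p.22] -/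
theorem restrictEmb_injective (k : ι) : Function.Injective (restrictEmb N C k) :=
  Subtype.coe_injective

/-- The range of the inclusion is `C_k ∩ N ≤ N`. [cite: MochizukiSemiAnbd2006, §2 p.23] -/
theorem range_restrictEmb (k : ι) : (restrictEmb N C k).toMonoidHom.range = (C k).subgroupOf N :=
  Subgroup.range_subtype _

/-! ## 2. Transfer of the estrangement law, infinitude, compactness -/

omit [TopologicalSpace Δ] in
/-- Mapping `H.subgroupOf N ⊓ (H'.subgroupOf N)^g` into `Δ` lands in `H ⊓ H'^g`. [cite: MochizukiSemiAnbd2006, Def 2.4(iv) p.26] -/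
theorem map_subtype_inf_conj_le (H H' : Subgroup Δ) (g : N) :
    (H.subgroupOf N ⊓ (H'.subgroupOf N).map (MulAut.conj g).toMonoidHom).map N.subtype ≤
      H ⊓ H'.map (MulAut.conj (g : Δ)).toMonoidHom := by
  rintro _ ⟨x, ⟨hx, hx'⟩, rfl⟩
  refine ⟨Subgroup.mem_subgroupOf.mp hx, ?_⟩
  obtain ⟨y, hy, hyx⟩ := Subgroup.mem_map.mp hx'
  refine Subgroup.mem_map.mpr ⟨(y : Δ), Subgroup.mem_subgroupOf.mp hy, ?_⟩
  have := congrArg (fun z : N => (z : Δ)) hyx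
  simpa using this

/-- **The estrangement law restricts to `N`**: from `C k ∩ g C k' g⁻¹ = 1` in `Δ` (for `k' ≠ k` or `g ∉ C k`) to the
same for the `C k ∩ N` inside `N`, in the `hest` currency of `OneVertexCusps.thm37Hypotheses`.
[cite: MochizukiSemiAnbd2006, Def 2.4(iv) p.26] -/
theorem restrict_estranged
    (hest : ∀ (k k' : ι) (g : Δ), (k' ≠ k ∨ g ∉ C k) → C k ⊓ (C k').map (MulAut.conj g).toMonoidHom = ⊥)
    (k k' : ι) (g : N) (hg : k' ≠ k ∨ g ∉ (restrictEmb N C k).toMonoidHom.range) :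
    (restrictEmb N C k).toMonoidHom.range ⊓
      ((restrictEmb N C k').toMonoidHom.range.map (MulAut.conj g).toMonoidHom) = ⊥ := by
  rw [range_restrictEmb, range_restrictEmb, eq_bot_iff]
  intro x hx
  have hΔ : (x : Δ) ∈ C k ⊓ (C k').map (MulAut.conj (g : Δ)).toMonoidHom :=
    map_subtype_inf_conj_le N (C k) (C k') g ⟨x, hx, rfl⟩
  have hg' : k' ≠ k ∨ (g : Δ) ∉ C k := hg.imp id fun h hmem => h (by
    rw [range_restrictEmb]; exact Subgroup.mem_subgroupOf.mpr hmem)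
  rw [hest k k' g hg'] at hΔ
  rw [Subgroup.mem_bot]
  exact Subtype.ext (Subgroup.mem_bot.mp hΔ)

omit [TopologicalSpace Δ] in
/-- A finite-index subgroup of an infinite group is infinite (`|Δ| = [Δ : N]·|N|`). [folklore] -/
private theorem infinite_of_finiteIndex [Infinite Δ] [N.FiniteIndex] : Infinite N := by
  by_contra hfin
  rw [not_infinite_iff_finite] at hfin
  have hcard := Subgroup.card_eq_card_quotient_mul_card_subgroup N
  rw [Nat.card_eq_zero_of_infinite (α := Δ)] at hcard
  haveI : Nonempty (Δ ⧸ N) := ⟨((1 : Δ) : Δ ⧸ N)⟩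
  exact mul_ne_zero (Nat.card_pos (α := Δ ⧸ N)).ne' (Nat.card_pos (α := N)).ne' hcard.symm

omit [TopologicalSpace Δ] in
/-- **`C ∩ N` is infinite** when `C` is infinite and `N` has finite index (`[C : C ∩ N] ≤ [Δ : N]`).
[cite: MochizukiSemiAnbd2006, Def 2.4(iv) p.26] -/
theorem infinite_subgroupOf_of_finiteIndex (H : Subgroup Δ) [hH : Infinite H] [N.FiniteIndex] :
    Infinite (H.subgroupOf N) := by
  haveI : N.IsFiniteRelIndex H := Subgroup.isFiniteRelIndex_of_finiteIndex
  haveI : Infinite (N.subgroupOf H) := infinite_of_finiteIndex (Δ := H) (N.subgroupOf H)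
  -- `N ∩ H` viewed in `H` and in `N` are the same set
  let e : N.subgroupOf H → H.subgroupOf N := fun x =>
    ⟨⟨((x : H) : Δ), Subgroup.mem_subgroupOf.mp x.2⟩, Subgroup.mem_subgroupOf.mpr (x : H).2⟩
  refine Infinite.of_injective e fun x y hxy => ?_
  have : ((x : H) : Δ) = ((y : H) : Δ) := congrArg (fun z : H.subgroupOf N => ((z : N) : Δ)) hxy
  exact Subtype.ext (Subtype.ext this)

/-- `C ∩ N ≤ N` is closed when `C` is. [cite: MochizukiSemiAnbd2006, Def 2.4(iv) p.26] -/
theorem isClosed_subgroupOf (H : Subgroup Δ) (hH : IsClosed (H : Set Δ)) :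
    IsClosed ((H.subgroupOf N : Subgroup N) : Set N) := by
  rw [Subgroup.coe_subgroupOf]
  exact hH.preimage continuous_subtype_val

/-- `C ∩ N` is compact when `C` is closed and `N` is closed in a compact `Δ`. [cite: MochizukiSemiAnbd2006, Def 2.4(iv) p.26] -/
theorem compactSpace_subgroupOf [CompactSpace Δ] (hN : IsClosed (N : Set Δ)) (H : Subgroup Δ)
    (hH : IsClosed (H : Set Δ)) : CompactSpace (H.subgroupOf N) := by
  haveI : CompactSpace N := isCompact_iff_compactSpace.mp (hN.isCompact)
  exact isCompact_iff_compactSpace.mp (isClosed_subgroupOf N H hH).isCompact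

/-- Open subgroups of slim groups are slim (copy of abc-iut-L3-t2's lemma; [SemiAnbd] §0 p. 6 "slim").
[cite: MochizukiSemiAnbd2006, §0 p.6] -/
theorem isSlimGroup_of_isOpen [ContinuousMul Δ] (hΔ : IsSlimGroup Δ) (hN : IsOpen (N : Set Δ)) :
    IsSlimGroup N := by
  refine ⟨fun U hU => ?_⟩
  have hUo : IsOpen ((U.map N.subtype : Subgroup Δ) : Set Δ) := by
    have : ((U.map N.subtype : Subgroup Δ) : Set Δ) = Subtype.val '' (U : Set N) := by
      ext x; simp
    rw [this]
    exact hN.isOpenMap_subtype_val _ hU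
  have hc := hΔ.centralizer_eq_bot _ hUo
  refine (Subgroup.eq_bot_iff_forall _).mpr fun c hc' => ?_
  have hcG : (c : Δ) ∈ Subgroup.centralizer ((U.map N.subtype : Subgroup Δ) : Set Δ) := by
    rw [Subgroup.mem_centralizer_iff]
    rintro _ ⟨u, hu, rfl⟩
    exact congrArg Subtype.val (Subgroup.mem_centralizer_iff.mp hc' u hu)
  rw [hc] at hcG
  exact Subtype.ext (Subgroup.mem_bot.mp hcG)

/-! ## 3. The fibre over `N` and its Thm. 3.7 hypotheses -/

section Fibre

variable [IsTopologicalGroup Δ] [CompactSpace Δ] [TotallyDisconnectedSpace Δ]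
variable (hN : IsClosed (N : Set Δ)) (hC : ∀ k, IsClosed (C k : Set Δ))

/-- **The fibre over `N`**: the one-vertex semi-graph of anabelioids with vertex group `N` and cusps `k : ι` with
edge groups `C_k ∩ N` (local presentation; compactness of the constituents from the closedness of `N`, `C_k`).
[cite: MochizukiSemiAnbd2006, Ex 3.10 p.44] -/
def restrictGraph : ProfiniteSemiGraph.{u} :=
  haveI : CompactSpace N := isCompact_iff_compactSpace.mp hN.isCompact
  haveI : ∀ k, CompactSpace ((C k).subgroupOf N) := fun k => compactSpace_subgroupOf N hN (C k) (hC k)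
  graph (ι := ι) N (fun k => ↥((C k).subgroupOf N)) (restrictEmb N C)

/-- The underlying semi-graph of the fibre is `OneVertexCusps.semiGraph ι` (definitionally).
[cite: MochizukiSemiAnbd2006, Ex 3.10 p.44] -/
theorem restrictGraph_graph : (restrictGraph N C hN hC).graph = semiGraph ι := rfl

/-- **The explicit tempered fundamental group of the fibre over `N` is `N` itself** (`OneVertexCusps.chart`:
cusp omission then abc-iut-L3-t6's single-vertex chart). [cite: MochizukiSemiAnbd2006, Prop 3.6(ii) p.38] -/
def restrictChart [SecondCountableTopology Δ] : TemperedPiChart (restrictGraph N C hN hC) :=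
  haveI : CompactSpace N := isCompact_iff_compactSpace.mp hN.isCompact
  haveI : ∀ k, CompactSpace ((C k).subgroupOf N) := fun k => compactSpace_subgroupOf N hN (C k) (hC k)
  haveI : SecondCountableTopology N := TopologicalSpace.Subtype.secondCountableTopology _
  OneVertexCusps.chart (ι := ι) N (fun k => ↥((C k).subgroupOf N)) (restrictEmb N C)

/-- `π₁^temp(fibre over N) = N` on the nose. [cite: MochizukiSemiAnbd2006, Prop 3.6(ii) p.38] -/
theorem restrictChart_G [SecondCountableTopology Δ] : (restrictChart N C hN hC).G = N := rfl

/-- **The fibre over an OPEN subgroup satisfies the hypotheses of [SemiAnbd] Thm. 3.7** for finitely many cusps,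
provided `Δ` is slim, Hausdorff, second countable and infinite, the `C k` are closed, infinite and ESTRANGED IN
`Δ`, and `N` carries an elevation datum against the `C k ∩ N`. [cite: MochizukiSemiAnbd2006, Thm 3.7 p.40] -/
theorem restrict_thm37Hypotheses [Finite ι] [T2Space Δ] [SecondCountableTopology Δ] [Infinite Δ]
    (hNo : IsOpen (N : Set Δ)) (hslim : IsSlimGroup Δ) (hinf : ∀ k, Infinite (C k))
    (hest : ∀ (k k' : ι) (g : Δ), (k' ≠ k ∨ g ∉ C k) → C k ⊓ (C k').map (MulAut.conj g).toMonoidHom = ⊥)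
    (helev : ∀ M : ℕ, ∃ (F : Type u) (_ : Group F) (_ : Finite F) (π : N →* F),
      IsOpen (π.ker : Set N) ∧ Function.Surjective π ∧ ∃ S : Subgroup F, M ≤ Nat.card S ∧
        ∀ (k : ι) (g : F),
          S ⊓ ((π.comp (restrictEmb N C k).toMonoidHom).range.map (MulAut.conj g).toMonoidHom) = ⊥) :
    (restrictGraph N C hN hC).Thm37Hypotheses := by
  haveI : CompactSpace N := isCompact_iff_compactSpace.mp hN.isCompact
  haveI : ∀ k, CompactSpace ((C k).subgroupOf N) := fun k => compactSpace_subgroupOf N hN (C k) (hC k)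
  haveI : Finite (Δ ⧸ N) := N.quotient_finite_of_isOpen hNo
  haveI : N.FiniteIndex := Subgroup.finiteIndex_of_finite_quotient
  haveI : Infinite N := infinite_of_finiteIndex N
  haveI : SecondCountableTopology N := TopologicalSpace.Subtype.secondCountableTopology _
  obtain ⟨L⟩ := LevelFamily.nonempty_of_infinite (N : Type u)
  haveI : ∀ k, Infinite ((C k).subgroupOf N) := fun k => infinite_subgroupOf_of_finiteIndex N (C k)
  exact OneVertexCusps.thm37Hypotheses L (isSlimGroup_of_isOpen N hslim hNo) (restrictEmb_injective N C)
    (fun k => inferInstance) (restrict_estranged N C hest) helev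

end Fibre

end OneVertexCusps

end Literature.AnabelianGeometry.SemiGraphs

end
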